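import Summits.CriticalPhenomena.PercolationContinuityZ3.Theorems.Transplant.FKConjectureCGraphic
import Summits.CriticalPhenomena.PercolationContinuityZ3.Theorems.Transplant.FKPairMarginal
import Summits.CriticalPhenomena.PercolationContinuityZ3.Theorems.Transplant.FKConnectivityAllQSPDefs
import HarnessLib

/-!
# THE 2-POINT LAWS K1 / SP-PM OF THE C″ LINE CARD: `SR_J(e,f) ≥ 0` FOR THE C″ KERNEL OF EVERY FINITE SIMPLE GRAPH (K1, `@[conjecture]`), ON
# TWO-TERMINAL SERIES–PARALLEL GRAPHS (SP-PM, `@[conjecture]` — pen theorem of the memo, NOT a kernel theorem), AND THE PROVED CHAIN C″ ⇒ K1 ⇒ SP-PM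

Claimed R42 (8)(c) in the cell INBOX at 2026-08-29T12:01:25Z by fkp-10a gen 360 (NEW CLAIM #2 of the gen: the SP-PM FRONTIER slot licensed by director-frontier g17, cell INBOX l.8908, pre-cleared by coordinator fk-4 g296, l.8909 (3)), addressed to the lane under (ι) and to the next seated fk-4 generation (ruling R183 requested); lineage row FO-10a-g360s (self-suggested), package g360-sppm, label SP-PM.
STATEMENT_OF_RECORD: `ideation/prim-bschramm-fk-idea-4/gen4/lean/SPPM_Statement.lean` sha256 2290a1b688ca4bc4… (49 l.; fk-idea-4 gen 4; fk-crit-1 g3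
check (1); coordinator fk-4 g296 probe rc 0, cell INBOX l.8909 (3)(b)) — the two `def … : Prop` bodies and the two bookkeeping theorems below are
byte-for-byte those of the statement of record; this file adds the `@[conjecture]` tags, the docstrings and this page.
Statement-only FRONTIER file of the `fk-continuity` build cell (bschramm lane; `--supports stmt-CriticalPhenomena-4575 --as helper`), typed by the lane's
ledger writer (fkp-10a gen 360, package g360-sppm, label SP-PM) on director-frontier g17's LICENCE (cell INBOX l.8908 WORD 2, executing director-frontier
g16's ROUTE l.8881 (ii) and coordinator fk-4 g295's word l.8882 (ii); registry path + pre-clearance by coordinator fk-4 g296, l.8909 (3)); builds on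
p205010 (kernel theorem, internal audit signed; external expert review pending).  TWO `@[conjecture] def`s (NOT asserted), two one-line bookkeeping
theorems applying landed declarations, no named facts, no sorries, no instances, no notation, standard axioms.  «FRONTIER rung F-BS / FBP₀; a typed
pair-marginal statement about the lane's own kernel proves nothing about `p_c`; nothing percolation-bearing; typed ≠ proved.»

THE NODE AND ITS 2-POINT SHADOW.  C″ = `FK.ConjectureCGraphic` (`Transplant/FKConjectureCGraphic`, p710750; `@[conjecture]`, OPEN): for every finite
simple graph `G` and level `J` the doubly odd nullity-level kernel `conjCKernel ((cycleMatroid G).restrictSubtype G.edgeSet) J` lies in the pair-square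
cone.  The 2-point-marginal test `FK.pairMarginal_nonneg_of_inPairSquareCone` (`Transplant/FKPairMarginal`, p711218) turns cone membership into the
family of linear inequalities `SR_J(e,f) = Σ_{x ∋ e, y ∋ f} K_J(x,y) ≥ 0`; these are the functionals by which the spikes `S₁₀` (p703849) and `S₈⁺`
(p711419) refute the ALL-MATROID node.  On graphs:

* `FK.PairMarginalLawGraphic` (CARD-4 **K1**, `@[conjecture]`, NOT asserted) — the all-graph 2-point law: `SR_J(e,f) ≥ 0` for the C″ kernel of every
  finite simple graph, all edges `e ≠ f`, all `J`.  A CONSEQUENCE of C″ (`pairMarginalLawGraphic_of_conjectureCGraphic`); OPEN in general; verified by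
  exact rational arithmetic on all strip families up to 63 edges (fk-idea-4 gen-4 census) — evidence, not proof.
* `FK.SPPairMarginalLaw` (**SP-PM**, `@[conjecture]`, NOT asserted in the tree) — the 2-point law for every finite simple graph whose edge set is a
  two-terminal series–parallel network (`FK.IsTTSP G.edgeFinset s t`, `Transplant/FKConnectivityAllQSPDefs`).  THEOREM SP-PM of the lane memo
  `THEOREM-SP-PAIRMARGINAL.md` (fk-idea-4 gen 4: pen proof by the swap-involution / transfer-product argument of CARD-4 + machine checks; graded PASS by
  fk-crit-1 g3, prim/bschramm/STATUS l.403) — NOT a kernel theorem: in the tree it is a conjecture-tagged STATEMENT until a Lean proof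
  `theorem sPPairMarginalLaw : SPPairMarginalLaw` lands as a separate file (never a re-cut of this one).
* `FK.pairMarginalLawGraphic_of_conjectureCGraphic` (C″ ⇒ K1) and `FK.sPPairMarginalLaw_of_pairMarginalLawGraphic` (K1 ⇒ SP-PM) — the PROVED
  bookkeeping chain (one-line applications of p711218 / of the definition).

STATUS (2026-08-29, NOT kernel): C″ decided true by exact LP certificates on `M(K₅)`, `M(K₃,₃)`, their duals, `M(K₄)`, `W₃`, `W₄`, the graphic
`≤ 8`-element census; K1 checked exactly on strip families to 63 edges; SP-PM proved on paper; the one-edge-conditioned strengthening across a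
2-separation is FALSE (fk-crit-1 g3 Finding 12.2: `W₄` `(−2, 54, 8)`, octahedron + chord), so no statewise proof of K1 across 2-sums.

## References

* D. G. Wagner, *Negatively correlated random variables and Mason's conjecture for independent sets in matroids*, Ann. Comb. 12 (2008) 211–239;
  arXiv:math/0602648 (2006), Thm. 5.8(d), §5.3 (series–parallel graphs are Rayleigh). [Wagner2006]
* G. Grimmett, *The Random-Cluster Model*, Springer (2006), §3.8 Thm. (3.90), §3.9 (negative association, open problems). [Grimmett2006]
* J. Oxley, *Matroid Theory*, 2nd ed., OUP (2011), §1.3, §5.1 (graphic matroids), §5.4 (series–parallel networks). [Oxley2011]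
-/

namespace Summit.CriticalPhenomena.PercolationContinuityZ3.Theorems

namespace FK

open Literature.Combinatorics.SimpleGraph.TuttePolynomial

/-- **CARD-4 K1 — the all-graph 2-point law (`FK.PairMarginalLawGraphic`, NOT asserted):** for every finite simple graph `G`, every level `J` and all
edges `e ≠ f`, the pair marginal of the C″ kernel is nonnegative, `0 ≤ SR_J(e,f) = Σ_{x ∋ e, y ∋ f} K_J(x,y)` with
`K_J = conjCKernel ((cycleMatroid G).restrictSubtype G.edgeSet) J`.  A consequence of C″ (`pairMarginalLawGraphic_of_conjectureCGraphic`); OPEN in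
general; exact checks on strip families to 63 edges are evidence, not proof; nothing percolation-bearing follows from the definition.
[cite: Wagner2006, Thm. 5.8(d), §5.3] [cite: Oxley2011, §5.1 and §1.3] -/
@[conjecture] def PairMarginalLawGraphic : Prop :=
  ∀ (V : Type) [Fintype V] [DecidableEq V] (G : SimpleGraph V) [DecidableRel G.Adj] (J : ℕ) (e f : ↥G.edgeSet), e ≠ f →
    0 ≤ pairMarginal (conjCKernel ((cycleMatroid G).restrictSubtype G.edgeSet) J) e f

/-- **SP-PM — the 2-point law on two-terminal series–parallel simple graphs (`FK.SPPairMarginalLaw`, NOT asserted in the tree):** for every finite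
simple graph `G` whose edge set is a two-terminal series–parallel network with terminals `s, t` (`FK.IsTTSP G.edgeFinset s t`), every level `J` and
all edges `e ≠ f`, `0 ≤ SR_J(e,f)` for the C″ kernel.  THEOREM SP-PM of the lane memo `THEOREM-SP-PAIRMARGINAL.md` (pen proof + machine checks,
graded PASS) — NOT a kernel theorem; a Lean proof, if it lands, is a separate `theorem sPPairMarginalLaw : SPPairMarginalLaw`.
[cite: Wagner2006, Thm. 5.8(d), §5.3] [cite: Oxley2011, §5.4] [cite: Grimmett2006, §3.9] -/
@[conjecture] def SPPairMarginalLaw : Prop :=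
  ∀ (V : Type) [Fintype V] [DecidableEq V] (G : SimpleGraph V) [DecidableRel G.Adj] (s t : V),
    IsTTSP G.edgeFinset s t →
    ∀ (J : ℕ) (e f : ↥G.edgeSet), e ≠ f →
      0 ≤ pairMarginal (conjCKernel ((cycleMatroid G).restrictSubtype G.edgeSet) J) e f

/-- **C″ ⟹ K1**: the landed 2-point-marginal test `FK.pairMarginal_nonneg_of_inPairSquareCone` (p711218) applied pointwise to the cone membership that
C″ asserts. [cite: Wagner2006, Thm. 5.8(d), §5.3] -/
theorem pairMarginalLawGraphic_of_conjectureCGraphic (h : ConjectureCGraphic) : PairMarginalLawGraphic := by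
  intro V _ _ G _ J e f _
  exact pairMarginal_nonneg_of_inPairSquareCone (h V G J) e f

/-- **K1 ⟹ SP-PM**: the all-graph law contains the series–parallel law. [cite: Oxley2011, §5.4] -/
theorem sPPairMarginalLaw_of_pairMarginalLawGraphic (h : PairMarginalLawGraphic) : SPPairMarginalLaw := by
  intro V _ _ G _ s t _ J e f hef
  exact h V G J e f hef

end FK

end Summit.CriticalPhenomena.PercolationContinuityZ3.Theorems
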